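import Literature.NumberTheory.EllipticCurves.KubertTateFiveMuDescentGaussianMatrix
import Literature.NumberTheory.EllipticCurves.KubertTate14613GaussianValuations
import Literature.NumberTheory.EllipticCurves.KubertTate14613ShaFive
import Literature.NumberTheory.EllipticCurves.KubertTateFiveGaussianTwistRankZero
import Mathlib.Tactic.NormNum.Prime
import HarnessLib

/-!
# The first `5`-descent over `ℚ(i)` with SPLIT primes: `E_{146/13} ⊗ ℚ(i)` has rank `4` and `Ш[5^∞] = 0`;
# the quadratic twist `E_{146/13}^{(-4)}/ℚ` — no rational `5`-torsion — has RANK `2` and `t₅ = 0`, by descent alone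

PROOF-ONLY file (theorems only, no definition, no named fact, no `sorry`), topic `NumberTheory/EllipticCurves`;
an INSTANCE of the matrix form of the `5`-isogeny descent of the Kubert–Tate family over the Gaussian field
(`KubertTateFiveMuDescentGaussianMatrix.shaCorank_five_eq_zero_of_matrix`,
`mordellWeilRank_succ_eq_of_matrix`) at `(m, n) = (146, 13)`:

  `E = E_{146/13} = [-133, -1898, -24674, 0, 0]`, `Δ = 2⁵·13⁵·73⁵·269`, `rank E(ℚ) = 2`, `t₅(E) = 0`
  (tree `KubertTate14613Descent`); `mn = 2·13·73` with `13, 73 ≡ 1 (mod 4)` SPLIT in `ℤ[i]`.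

Over `K = ℚ(i)` (any `K` with `IsCyclotomicExtension {4} ℚ K`) the box has FIVE places `(1+ζ), (2±3ζ), (3±8ζ)`
(tree `KubertTate14613GaussianDescent.exists_places`) and is filled by the three `ℚ`-points `−T = (0, 24674)`,
`(-1168, -56064)`, `(3416, 513498)` together with the two `ℚ(i)`-points `Q₁ = (-3770, -238368 + 154076ζ)`,
`Q₂ = (-1898, -113880 + 26572ζ)` — the points `(u, Y) = (-3770, 308152)`, `(-1898, 53144)` of the twist
`Y² = -(4u³ + b₂u² + 2b₄u + b₆)` read on `E` as `(u, (ζY − a₁u − a₃)/2)`: the `5 × 5` matrix of orders of the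
Kummer values `f_T = xy − 13x² + 169y` relative to `f_T(2T)` (valuation table `log_valuation_points/base`),

  `M = [[4,3,3,2,2],[3,2,2,2,2],[4,2,2,3,3],[1,0,4,3,3],[1,4,0,2,4]]` (mod `5`, `log`-normalised),

is invertible mod `5` (inverse `[[2,0,2,0,0],[3,2,4,1,0],[1,2,4,4,0],[3,2,2,2,2],[0,2,2,3,3]]`): the twist rows differ
at the conjugate places, which no `ℚ`-point can do.  Hence, with NO `L`-function, `p`-adic or conjectural input:

* `shaCorank_five_eq_zero` — **`t₅(E_{146/13} ⊗ ℚ(i)) = 0`**; `sha_torsionBy_five_eq_bot` — `Ш(E ⊗ ℚ(i))[5] = 0`;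
* `mordellWeilRank_eq_four` — **`rank E_{146/13}(ℚ(i)) = 4`** (`#E(ℚ(i))[5] = 5`: no `ζ₅` in `ℚ(i)`);
* `mordellWeilRank_twist_eq_two` — **`rank E_{146/13}^{(-4)}(ℚ) = 2`** (`rank E(K) = rank E + rank E^{(d_K)}`, `d = -4`);
* `shaCorank_five_twist_eq_zero` — **`t₅(E_{146/13}^{(-4)}/ℚ) = 0`** (`t₅(E_K) = t₅(E) + t₅(E^{(-4)})`).

`E^{(-4)} ≅ E^{(-1)}` is a RANK-TWO elliptic curve over `ℚ` without a rational `5`-torsion point whose `5`-primary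
Tate–Shafarevich group is finite, indeed of corank `0`, by descent alone — the door at the admissible prime `5`
(good, ordinary) on a rank-`2` curve outside the rational-`5`-torsion classes (transfer statement T, stmt-22356).
BSD is not proved by this.

## References

* [SilvermanAEC2009] J. H. Silverman, *AEC*, 2nd ed., Thm. X.4.2, Prop. X.4.9, Exercise 10.1(c), Exercise 10.16,
  VII.3.1(b).
* [Fisher2001FiveSevenDescent] T. Fisher, JEMS 3 (2001), §§1–2.
* [IrelandRosen1982] K. Ireland, M. Rosen, *A Classical Introduction to Modern Number Theory*, Ch. 9 §7 Lemmas 3–5.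
* [Dokchitser2013ParityNotes] T. Dokchitser, Notes on the parity conjecture (2013), §4.
-/

noncomputable section

open scoped Classical NNReal NumberField AddSubgroup
open WeierstrassCurve WeierstrassCurve.Isogeny Field IsDedekindDomain Ideal
open Literature.NumberTheory.EllipticCurves Literature.NumberTheory.EllipticCurves.KubertTateVelu
  Literature.NumberTheory.EllipticCurves.KubertTateMuDescentNF Literature.NumberTheory.NumberFields

namespace Literature.NumberTheory.EllipticCurves

namespace KubertTate14613GaussianDescent

variable {K : Type} [Field K] [NumberField K] [IsCyclotomicExtension {4} ℚ K]

/-! ## §1 The curve and the points over `ℚ(i)` -/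

omit [IsCyclotomicExtension {4} ℚ K] in
/-- `E_{146/13} ⊗ K` is elliptic. [cite: Kubert1976, Table 3 (N = 5)] -/
theorem isElliptic : (kubertTateFive ((146 : ℤ) : K) ((13 : ℤ) : K)).IsElliptic :=
  haveI := KubertTate14613Descent.isElliptic
  KubertTateGaussianTwist.isElliptic_base (K := K) 146 13

omit [IsCyclotomicExtension {4} ℚ K] in
/-- The three `ℚ`-points `−T = (0, 24674)`, `(-1168, -56064)`, `(3416, 513498)`, the base point `2T = (1898, 277108)` and
the two twist points `(-3770, -238368 + 154076ζ)`, `(-1898, -113880 + 26572ζ)` (for `ζ² = -1`) lie on `E_{146/13} ⊗ K`.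
[cite: Fisher2001FiveSevenDescent, §2 (the family; these points verified in-file)] -/
theorem nonsingular_points {ζ : K} (hζ : ζ ^ 2 + 1 = 0) :
    (kubertTateFive ((146 : ℤ) : K) ((13 : ℤ) : K)).toAffine.Nonsingular 0 24674 ∧
    (kubertTateFive ((146 : ℤ) : K) ((13 : ℤ) : K)).toAffine.Nonsingular (-1168) (-56064) ∧
    (kubertTateFive ((146 : ℤ) : K) ((13 : ℤ) : K)).toAffine.Nonsingular 3416 513498 ∧
    (kubertTateFive ((146 : ℤ) : K) ((13 : ℤ) : K)).toAffine.Nonsingular (-3770) (-238368 + 154076 * ζ) ∧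
    (kubertTateFive ((146 : ℤ) : K) ((13 : ℤ) : K)).toAffine.Nonsingular (-1898) (-113880 + 26572 * ζ) ∧
    (kubertTateFive ((146 : ℤ) : K) ((13 : ℤ) : K)).toAffine.Nonsingular 1898 277108 := by
  haveI := isElliptic (K := K)
  refine ⟨?_, ?_, ?_, ?_, ?_, ?_⟩ <;>
    rw [← Affine.equation_iff_nonsingular, KubertTateMuDescentNF.equation_iff_base (K := K) 146 13] <;> push_cast
  · norm_num
  · norm_num
  · norm_num
  · linear_combination (23739413776 : K) * hζ
  · linear_combination (706071184 : K) * hζ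
  · norm_num

omit [IsCyclotomicExtension {4} ℚ K] in
/-- `P₁ = (-1168, -56064) ∈ E(ℚ)` (reference point of the `μ₅`-side). [cite: SilvermanAEC2009, VIII.§1] -/
theorem nonsingular_P₁_rat :
    (kubertTateFive (((146 : ℤ) : ℚ)) (((13 : ℤ) : ℚ))).toAffine.Nonsingular (-1168) (-56064) :=
  (KubertTate14613Descent.nonsingular_iff _ _).mpr (by norm_num)

/-! ## §2 Two places over different rational primes, or conjugate places, are distinct -/

omit [NumberField K] [IsCyclotomicExtension {4} ℚ K] in
/-- Places above different rational primes are different. [cite: IrelandRosen1982, Ch. 9 §7] -/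
private theorem ne_of_natCast_mem {v w : HeightOneSpectrum (𝓞 K)} {ℓ ℓ' : ℕ} (hℓ : ℓ.Prime) (hℓ' : ℓ'.Prime)
    (hne : ℓ ≠ ℓ') (h : (ℓ : 𝓞 K) ∈ v.asIdeal) (h' : (ℓ' : 𝓞 K) ∈ w.asIdeal) : v ≠ w := by
  rintro rfl
  have hd := natCast_dvd_of_intCast_mem hℓ h (d := ℓ') (by exact_mod_cast h')
  exact hne ((Nat.prime_dvd_prime_iff_eq hℓ hℓ').mp (by exact_mod_cast hd))

/-! ## §3 The descent over `ℚ(i)`: box full at five places -/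

/-- **The complete `5`-descent of `E_{146/13}` over `ℚ(i)`**: `t₅(E ⊗ ℚ(i)) = 0`, `Ш(E ⊗ ℚ(i))[5] = 0` and
`rank E(ℚ(i)) + 1 = 5` (box of five places filled by three `ℚ`-points and two twist points; matrix invertible mod `5`).
[cite: SilvermanAEC2009, Thm. X.4.2(a) and Thm. X.1.1] [cite: Fisher2001FiveSevenDescent, §2] -/
theorem descent :
    haveI := isElliptic (K := K)
    (kubertTateFive ((146 : ℤ) : K) ((13 : ℤ) : K)).shaCorank 5 = 0 ∧
      (kubertTateFive ((146 : ℤ) : K) ((13 : ℤ) : K)).sha[((5 : ℕ) : ℤ)] = ⊥ ∧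
      (kubertTateFive ((146 : ℤ) : K) ((13 : ℤ) : K)).mordellWeilRank + 1 = 5 := by
  haveI := isElliptic (K := K)
  haveI := KubertTate14613Descent.isElliptic
  haveI : Fact (Nat.Prime 3) := ⟨Nat.prime_three⟩
  -- the fourth root of unity and the places
  set ζ : 𝓞 K := (IsCyclotomicExtension.zeta_spec 4 ℚ K).toInteger with hζdef
  have hζ : IsPrimitiveRoot ζ 4 := (IsCyclotomicExtension.zeta_spec 4 ℚ K).toInteger_isPrimitiveRoot
  have hsq : ζ ^ 2 + 1 = 0 := by
    rw [(hζ.pow (by norm_num) (show 4 = 2 * 2 by norm_num)).eq_neg_one_of_two_right, neg_add_cancel]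
  have hsqK : (ζ : K) ^ 2 + 1 = 0 := by
    have := congrArg (fun t : 𝓞 K ↦ (t : K)) hsq
    simpa [NumberField.RingOfIntegers.coe_eq_algebraMap] using this
  obtain ⟨v₀, v₁, v₂, v₃, v₄, hv₀, hv₁, hv₂, hv₃, hv₄⟩ := exists_places hζ
  obtain ⟨hℓ₀, hℓ₁, hℓ₂, hℓ₃, hℓ₄⟩ := natCast_mem_places hζ hv₀ hv₁ hv₂ hv₃ hv₄
  have hπ₀ : (1 : 𝓞 K) + ζ ∈ v₀.asIdeal := by rw [hv₀]; exact mem_span_singleton_self _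
  have hπ₁ : (2 : 𝓞 K) + 3 * ζ ∈ v₁.asIdeal := by rw [hv₁]; exact mem_span_singleton_self _
  have hπ₂ : (2 : 𝓞 K) - 3 * ζ ∈ v₂.asIdeal := by rw [hv₂]; exact mem_span_singleton_self _
  have hπ₃ : (3 : 𝓞 K) + 8 * ζ ∈ v₃.asIdeal := by rw [hv₃]; exact mem_span_singleton_self _
  have hπ₄ : (3 : 𝓞 K) - 8 * ζ ∈ v₄.asIdeal := by rw [hv₄]; exact mem_span_singleton_self _
  have p₀ : Prime ((1 : 𝓞 K) + ζ) := prime_one_add_four hζ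
  have p₁ : Prime ((2 : 𝓞 K) + 3 * ζ) := by
    simpa using prime_int_add_int_mul_four hζ (a := 2) (b := 3) (ℓ := 13) (by norm_num) (by norm_num)
  have p₂ : Prime ((2 : 𝓞 K) - 3 * ζ) := by
    have h := prime_int_add_int_mul_four hζ (a := 2) (b := -3) (ℓ := 13) (by norm_num) (by norm_num)
    have e : ((2 : ℤ) : 𝓞 K) + ((-3 : ℤ) : 𝓞 K) * ζ = (2 : 𝓞 K) - 3 * ζ := by push_cast; ring
    rwa [e] at h
  have p₃ : Prime ((3 : 𝓞 K) + 8 * ζ) := by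
    simpa using prime_int_add_int_mul_four hζ (a := 3) (b := 8) (ℓ := 73) (by norm_num) (by norm_num)
  have p₄ : Prime ((3 : 𝓞 K) - 8 * ζ) := by
    have h := prime_int_add_int_mul_four hζ (a := 3) (b := -8) (ℓ := 73) (by norm_num) (by norm_num)
    have e : ((3 : ℤ) : 𝓞 K) + ((-8 : ℤ) : 𝓞 K) * ζ = (3 : 𝓞 K) - 8 * ζ := by push_cast; ring
    rwa [e] at h
  -- distinctness of the five places
  have h01 : v₀ ≠ v₁ := ne_of_natCast_mem Nat.prime_two (by norm_num) (by norm_num) hℓ₀ hℓ₁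
  have h02 : v₀ ≠ v₂ := ne_of_natCast_mem Nat.prime_two (by norm_num) (by norm_num) hℓ₀ hℓ₂
  have h03 : v₀ ≠ v₃ := ne_of_natCast_mem Nat.prime_two (by norm_num) (by norm_num) hℓ₀ hℓ₃
  have h04 : v₀ ≠ v₄ := ne_of_natCast_mem Nat.prime_two (by norm_num) (by norm_num) hℓ₀ hℓ₄
  have h13 : v₁ ≠ v₃ := ne_of_natCast_mem (by norm_num) (by norm_num) (by norm_num) hℓ₁ hℓ₃
  have h14 : v₁ ≠ v₄ := ne_of_natCast_mem (by norm_num) (by norm_num) (by norm_num) hℓ₁ hℓ₄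
  have h23 : v₂ ≠ v₃ := ne_of_natCast_mem (by norm_num) (by norm_num) (by norm_num) hℓ₂ hℓ₃
  have h24 : v₂ ≠ v₄ := ne_of_natCast_mem (by norm_num) (by norm_num) (by norm_num) hℓ₂ hℓ₄
  have h12 : v₁ ≠ v₂ := by
    intro e
    have hmem : (2 : 𝓞 K) - 3 * ζ ∈ span {(2 : 𝓞 K) + 3 * ζ} := by rw [← hv₁, e]; exact hπ₂
    have := int_sub_int_mul_not_mem_span hζ (a := 2) (b := 3) (ℓ := 13) (by norm_num) (by norm_num) (by norm_num)
      (by norm_num)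
    exact this (by simpa using hmem)
  have h34 : v₃ ≠ v₄ := by
    intro e
    have hmem : (3 : 𝓞 K) - 8 * ζ ∈ span {(3 : 𝓞 K) + 8 * ζ} := by rw [← hv₃, e]; exact hπ₄
    have := int_sub_int_mul_not_mem_span hζ (a := 3) (b := 8) (ℓ := 73) (by norm_num) (by norm_num) (by norm_num)
      (by norm_num)
    exact this (by simpa using hmem)
  have hpl : Function.Injective ![v₀, v₁, v₂, v₃, v₄] := by
    intro i j h
    fin_cases i <;> fin_cases j
    · rfl
    · exact absurd h h01
    · exact absurd h h02
    · exact absurd h h03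
    · exact absurd h h04
    · exact absurd h h01.symm
    · rfl
    · exact absurd h h12
    · exact absurd h h13
    · exact absurd h h14
    · exact absurd h h02.symm
    · exact absurd h h12.symm
    · rfl
    · exact absurd h h23
    · exact absurd h h24
    · exact absurd h h03.symm
    · exact absurd h h13.symm
    · exact absurd h h23.symm
    · rfl
    · exact absurd h h34
    · exact absurd h h04.symm
    · exact absurd h h14.symm
    · exact absurd h h24.symm
    · exact absurd h h34.symm
    · rfl
  -- the support: off the five places, `146 = 2·73` and `13` are units
  have hS : ∀ v : HeightOneSpectrum (𝓞 K), (∀ j, ![v₀, v₁, v₂, v₃, v₄] j ≠ v) →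
      (((146 : ℤ) : ℤ) : 𝓞 K) ∉ v.asIdeal ∧ (((13 : ℤ) : ℤ) : 𝓞 K) ∉ v.asIdeal := by
    intro v hv
    have n0 : v₀ ≠ v := hv 0
    have n1 : v₁ ≠ v := hv 1
    have n2 : v₂ ≠ v := hv 2
    have n3 : v₃ ≠ v := hv 3
    have n4 : v₄ ≠ v := hv 4
    have hP := v.isPrime
    constructor
    · intro h146
      have e : (((146 : ℤ) : ℤ) : 𝓞 K) = ((2 : ℕ) : 𝓞 K) * ((73 : ℕ) : 𝓞 K) := by push_cast; norm_num
      rw [e] at h146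
      rcases hP.mem_or_mem h146 with h | h
      · -- `2 ∈ v` ⇒ `(1 + ζ)² = 2ζ ∈ v` ⇒ `1 + ζ ∈ v` ⇒ `v = v₀`
        have hl2 : ((1 : 𝓞 K) + ζ) ^ 2 ∈ v.asIdeal := by
          have e2 : ((1 : 𝓞 K) + ζ) ^ 2 = ζ * ((2 : ℕ) : 𝓞 K) := by push_cast; linear_combination hsq
          rw [e2]; exact v.asIdeal.mul_mem_left _ h
        exact n0 (eq_of_mem_of_mem_of_prime p₀ hπ₀ ((hP.pow_mem_iff_mem 2 (by norm_num)).mp hl2))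
      · rcases mem_or_mem_of_sq_add_sq_eq hζ (a := 3) (b := 8) (ℓ := 73) (by norm_num) h with h' | h'
        · exact n3 (eq_of_mem_of_mem_of_prime p₃ hπ₃ (by simpa using h'))
        · exact n4 (eq_of_mem_of_mem_of_prime p₄ hπ₄ (by simpa using h'))
    · intro h13mem
      have e : (((13 : ℤ) : ℤ) : 𝓞 K) = ((13 : ℕ) : 𝓞 K) := by push_cast; norm_num
      rw [e] at h13mem
      rcases mem_or_mem_of_sq_add_sq_eq hζ (a := 2) (b := 3) (ℓ := 13) (by norm_num) h13mem with h' | h'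
      · exact n1 (eq_of_mem_of_mem_of_prime p₁ hπ₁ (by simpa using h'))
      · exact n2 (eq_of_mem_of_mem_of_prime p₂ hπ₂ (by simpa using h'))
  -- the points
  obtain ⟨hn0, hn1, hn2, hn3, hn4, hnb⟩ := nonsingular_points hsqK
  -- the Kummer values as elements of `ℤ[i]`
  have hf : ∀ i : Fin 5, (![(0 : K), -1168, 3416, -3770, -1898] i) * (![(24674 : K), -56064, 513498,
      -238368 + 154076 * (ζ : K), -113880 + 26572 * (ζ : K)] i) - ((13 : ℤ) : K) * (![(0 : K), -1168, 3416, -3770, -1898] i) ^ 2 +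
      ((13 : ℤ) : K) ^ 2 * (![(24674 : K), -56064, 513498, -238368 + 154076 * (ζ : K), -113880 + 26572 * (ζ : K)] i) =
      ((![(4169906 : 𝓞 K), (38273024 : 𝓞 K), (1689192602 : 𝓞 K), (673595468 : 𝓞 K) - 554827676 * ζ,
          (150067268 : 𝓞 K) - 45942988 * ζ] i : 𝓞 K) : K) := by
    intro i
    fin_cases i
    · simp only [Fin.zero_eta, Matrix.cons_val_zero]
      simp only [map_ofNat]; push_cast; ring
    · simp only [Fin.mk_one, Matrix.cons_val_one, Matrix.cons_val_zero]
      simp only [map_ofNat]; push_cast; ring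
    · simp only [Fin.reduceFinMk, Matrix.cons_val]
      simp only [map_ofNat]; push_cast; ring
    · simp only [Fin.reduceFinMk, Matrix.cons_val]
      simp only [NumberField.RingOfIntegers.coe_eq_algebraMap, map_sub, map_mul, map_ofNat]; push_cast; ring
    · simp only [Fin.reduceFinMk, Matrix.cons_val]
      simp only [NumberField.RingOfIntegers.coe_eq_algebraMap, map_sub, map_mul, map_ofNat]; push_cast; ring
  have hfb : (1898 : K) * 277108 - ((13 : ℤ) : K) * 1898 ^ 2 + ((13 : ℤ) : K) ^ 2 * 277108 =
      (((525950984 : 𝓞 K) : 𝓞 K) : K) := by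
    simp only [map_ofNat]; push_cast; norm_num
  -- the matrix and its inverse mod 5
  have hmat : Matrix.of (fun i j : Fin 5 ↦
      ((WithZero.log ((![v₀, v₁, v₂, v₃, v₄] j).valuation K
          ((![(0 : K), -1168, 3416, -3770, -1898] i) * (![(24674 : K), -56064, 513498,
            -238368 + 154076 * (ζ : K), -113880 + 26572 * (ζ : K)] i) -
            ((13 : ℤ) : K) * (![(0 : K), -1168, 3416, -3770, -1898] i) ^ 2 +
            ((13 : ℤ) : K) ^ 2 * (![(24674 : K), -56064, 513498, -238368 + 154076 * (ζ : K),
              -113880 + 26572 * (ζ : K)] i))) -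
        WithZero.log ((![v₀, v₁, v₂, v₃, v₄] j).valuation K
          ((1898 : K) * 277108 - ((13 : ℤ) : K) * 1898 ^ 2 + ((13 : ℤ) : K) ^ 2 * 277108)) : ℤ) : ZMod 5)) =
      !![4, 3, 3, 2, 2; 3, 2, 2, 2, 2; 4, 2, 2, 3, 3; 1, 0, 4, 3, 3; 1, 4, 0, 2, 4] := by
    ext i j
    simp only [Matrix.of_apply]
    rw [hf i, hfb, log_valuation_points hζ hv₀ hv₁ hv₂ hv₃ hv₄ i j, log_valuation_base hζ hv₀ hv₁ hv₂ hv₃ hv₄ j]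
    fin_cases i <;> fin_cases j <;> decide
  have hinv : (!![2, 0, 2, 0, 0; 3, 2, 4, 1, 0; 1, 2, 4, 4, 0; 3, 2, 2, 2, 2; 0, 2, 2, 3, 3] : Matrix (Fin 5) (Fin 5) (ZMod 5)) *
      !![4, 3, 3, 2, 2; 3, 2, 2, 2, 2; 4, 2, 2, 3, 3; 1, 0, 4, 3, 3; 1, 4, 0, 2, 4] = 1 := by decide
  have hM : ∀ e : Fin 5 → ZMod 5, ∃ c : Fin 5 → ZMod 5, Matrix.vecMul c (Matrix.of (fun i j : Fin 5 ↦
      ((WithZero.log ((![v₀, v₁, v₂, v₃, v₄] j).valuation K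
          ((![(0 : K), -1168, 3416, -3770, -1898] i) * (![(24674 : K), -56064, 513498,
            -238368 + 154076 * (ζ : K), -113880 + 26572 * (ζ : K)] i) -
            ((13 : ℤ) : K) * (![(0 : K), -1168, 3416, -3770, -1898] i) ^ 2 +
            ((13 : ℤ) : K) ^ 2 * (![(24674 : K), -56064, 513498, -238368 + 154076 * (ζ : K),
              -113880 + 26572 * (ζ : K)] i))) -
        WithZero.log ((![v₀, v₁, v₂, v₃, v₄] j).valuation K
          ((1898 : K) * 277108 - ((13 : ℤ) : K) * 1898 ^ 2 + ((13 : ℤ) : K) ^ 2 * 277108)) : ℤ) : ZMod 5))) = e := by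
    intro e
    refine ⟨Matrix.vecMul e !![2, 0, 2, 0, 0; 3, 2, 4, 1, 0; 1, 2, 4, 4, 0; 3, 2, 2, 2, 2; 0, 2, 2, 3, 3], ?_⟩
    rw [hmat, Matrix.vecMul_vecMul, hinv, Matrix.vecMul_one]
  -- the reference point `P₁ = (-1168, -56064)`, `25 P₁ ≠ O` transported from `ℚ` (good prime `3`)
  have h25 := KubertTateGaussianTwist.twentyfive_zsmul_toGeomPoints_cast_ne_zero (K := K) 146 13 nonsingular_P₁_rat
    (by norm_num) (by norm_num) 3 (by norm_num) (by norm_num) KubertTate14613Descent.not_tor_dvd_Δ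
  refine ⟨?_, ?_, ?_⟩
  · exact KubertTateMuDescentNF.shaCorank_five_eq_zero_of_matrix 146 13 _ (fun σ ↦ smul_toGeomPoints _ σ _) h25
      KubertTate14613Descent.not_five_dvd_Δ KubertTate14613Descent.gaussian_tame ![v₀, v₁, v₂, v₃, v₄] hpl hS
      ![(0 : K), -1168, 3416, -3770, -1898]
      ![(24674 : K), -56064, 513498, -238368 + 154076 * (ζ : K), -113880 + 26572 * (ζ : K)]
      (fun i ↦ by fin_cases i <;> assumption) (fun i ↦ by fin_cases i <;> norm_num)
      1898 277108 hnb (by norm_num) hM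
  · exact KubertTateMuDescentNF.sha_torsionBy_five_eq_bot_of_matrix 146 13 _ (fun σ ↦ smul_toGeomPoints _ σ _) h25
      KubertTate14613Descent.not_five_dvd_Δ KubertTate14613Descent.gaussian_tame ![v₀, v₁, v₂, v₃, v₄] hpl hS
      ![(0 : K), -1168, 3416, -3770, -1898]
      ![(24674 : K), -56064, 513498, -238368 + 154076 * (ζ : K), -113880 + 26572 * (ζ : K)]
      (fun i ↦ by fin_cases i <;> assumption) (fun i ↦ by fin_cases i <;> norm_num)
      1898 277108 hnb (by norm_num) hM
  · exact KubertTateMuDescentNF.mordellWeilRank_succ_eq_of_matrix 146 13 _ (fun σ ↦ smul_toGeomPoints _ σ _) h25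
      KubertTate14613Descent.not_five_dvd_Δ KubertTate14613Descent.gaussian_tame ![v₀, v₁, v₂, v₃, v₄] hpl hS
      ![(0 : K), -1168, 3416, -3770, -1898]
      ![(24674 : K), -56064, 513498, -238368 + 154076 * (ζ : K), -113880 + 26572 * (ζ : K)]
      (fun i ↦ by fin_cases i <;> assumption) (fun i ↦ by fin_cases i <;> norm_num)
      1898 277108 hnb (by norm_num) hM

/-! ## §4 The theorems -/

/-- **`t₅(E_{146/13} ⊗ ℚ(i)) = corank_{ℤ₅} Ш(E_{146/13}/ℚ(i))[5^∞] = 0`, UNCONDITIONALLY**, by the complete `5`-descent over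
`ℚ(i)` at five places (two of them pairs of conjugate split primes). [cite: SilvermanAEC2009, Thm. X.4.2(a)]
[cite: Fisher2001FiveSevenDescent, §2] -/
theorem shaCorank_five_eq_zero :
    haveI := isElliptic (K := K)
    (kubertTateFive ((146 : ℤ) : K) ((13 : ℤ) : K)).shaCorank 5 = 0 := (descent (K := K)).1

/-- **`Ш(E_{146/13}/ℚ(i))[5] = 0`, unconditionally.** [cite: SilvermanAEC2009, Thm. X.4.2(a)] -/
theorem sha_torsionBy_five_eq_bot :
    haveI := isElliptic (K := K)
    (kubertTateFive ((146 : ℤ) : K) ((13 : ℤ) : K)).sha[((5 : ℕ) : ℤ)] = ⊥ := (descent (K := K)).2.1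

/-- **`rank E_{146/13}(ℚ(i)) = 4`, unconditionally** (the descent over `ℚ(i)` computes the rank: box of five places
full, `#E(ℚ(i))[5] = 5`). [cite: SilvermanAEC2009, Thm. X.4.2 and Thm. X.1.1] -/
theorem mordellWeilRank_eq_four :
    haveI := isElliptic (K := K)
    (kubertTateFive ((146 : ℤ) : K) ((13 : ℤ) : K)).mordellWeilRank = 4 := by
  have h := (descent (K := K)).2.2
  omega

/-- **`rank E_{146/13}^{(-4)}(ℚ) = 2`, unconditionally**: `rank E(ℚ(i)) = rank E(ℚ) + rank E^{(-4)}(ℚ)` (`d_{ℚ(i)} = -4`;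
tree `KubertTateGaussianTwist.mordellWeilRank_base_eq_add`) with `4 = 2 + rank E^{(-4)}(ℚ)`
(`KubertTate14613Descent.mordellWeilRank_eq`). [cite: SilvermanAEC2009, Exercise 10.16] -/
theorem mordellWeilRank_twist_eq_two (K : Type) [Field K] [NumberField K] [IsCyclotomicExtension {4} ℚ K] :
    haveI := KubertTate14613Descent.isElliptic
    ∀ [((kubertTateFive (((146 : ℤ) : ℚ)) (((13 : ℤ) : ℚ))).quadraticTwist (-4)).IsElliptic],
      ((kubertTateFive (((146 : ℤ) : ℚ)) (((13 : ℤ) : ℚ))).quadraticTwist (-4)).mordellWeilRank = 2 := by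
  haveI := KubertTate14613Descent.isElliptic
  intro htw
  have hR := KubertTateGaussianTwist.mordellWeilRank_base_eq_add (K := K) 146 13
  have h4 := mordellWeilRank_eq_four (K := K)
  have h2 := KubertTate14613Descent.mordellWeilRank_eq
  omega

/-- Transport of `t_p` along an equality of curves. [folklore] -/
private theorem shaCorank_congr {F : Type} [Field F] [NumberField F] {V V' : WeierstrassCurve F}
    [V.IsElliptic] [V'.IsElliptic] (e : V = V') (p : ℕ) [Fact p.Prime] : V.shaCorank p = V'.shaCorank p := by
  subst e; rfl

/-- `[ℚ(ζ₄) : ℚ] = 2`. [folklore] -/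
private theorem finrank_rat_four : Module.finrank ℚ K = 2 := by
  rw [IsCyclotomicExtension.finrank (n := 4) K (Polynomial.cyclotomic.irreducible_rat (by norm_num)),
    show Nat.totient 4 = 2 by decide]

/-- **`t₅(E_{146/13}^{(-4)}/ℚ) = 0`, unconditionally** — the door at `5` on a RANK-`2` twist WITHOUT a rational
`5`-torsion point: `t₅(E_K) = t₅(E) + t₅(E^{(d_K)})` (`corank Sel(E_K) = corank Sel(E) + corank Sel(E^{(d_K)})`, tree
`selmerCorank_baseChange_quadratic_holds`; `rank E(K) = rank E + rank E^{(d_K)}`; Greenberg's `corank Sel = rank + t`)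
with `t₅(E_K) = 0`. [cite: Dokchitser2013ParityNotes, §4] [cite: SilvermanAEC2009, Thm. X.4.2] -/
theorem shaCorank_five_twist_eq_zero (K : Type) [Field K] [NumberField K] [IsCyclotomicExtension {4} ℚ K] :
    haveI := KubertTate14613Descent.isElliptic
    ∀ [((kubertTateFive (((146 : ℤ) : ℚ)) (((13 : ℤ) : ℚ))).quadraticTwist (-4)).IsElliptic],
      ((kubertTateFive (((146 : ℤ) : ℚ)) (((13 : ℤ) : ℚ))).quadraticTwist (-4)).shaCorank 5 = 0 := by
  haveI : Fact (Nat.Prime 5) := ⟨Nat.prime_five⟩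
  haveI := isElliptic (K := K)
  haveI := KubertTate14613Descent.isElliptic
  intro htw
  set W := kubertTateFive (((146 : ℤ) : ℚ)) (((13 : ℤ) : ℚ)) with hW
  haveI hbc : (W.baseChange K).IsElliptic := by
    rw [hW, KubertTateMuDescentNF.baseChange_eq (K := ℚ) 146 13 K]; exact isElliptic
  have hd : ((NumberField.discr K : ℤ) : ℚ) ≠ 0 := by exact_mod_cast NumberField.discr_ne_zero K
  haveI : (W.quadraticTwist (NumberField.discr K : ℚ)).IsElliptic := isElliptic_quadraticTwist _ hd
  have hS := selmerCorank_baseChange_quadratic_holds W K finrank_rat_four 5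
  have hR := mordellWeilRank_baseChange_quadratic_holds W K finrank_rat_four
  have hK := (W.baseChange K).selmerCorank_eq_mordellWeilRank_add_holds 5
  have hQ := W.selmerCorank_eq_mordellWeilRank_add_holds 5
  have hT := (W.quadraticTwist (NumberField.discr K : ℚ)).selmerCorank_eq_mordellWeilRank_add_holds 5
  have h0 : (W.baseChange K).shaCorank 5 = 0 := by
    rw [shaCorank_congr (KubertTateMuDescentNF.baseChange_eq (K := ℚ) 146 13 K) 5]
    exact shaCorank_five_eq_zero (K := K)
  have h4 : ((NumberField.discr K : ℤ) : ℚ) = -4 := by rw [discr_of_isCyclotomicExtension_four K]; norm_num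
  rw [h4] at hS hR hT
  omega

/-- **Both components at once, over the concrete carrier `CyclotomicField 4 ℚ`**: `rank E_{146/13}^{(-4)}(ℚ) = 2` and
`t₅(E_{146/13}^{(-4)}/ℚ) = 0`, together with `t₅(E_{146/13}/ℚ) = 0` (tree `KubertTate14613Descent.shaCorank_five_eq_zero`).
[cite: SilvermanAEC2009, Thm. X.4.2 and Exercise 10.16] -/
theorem twist_146_13 :
    haveI := KubertTate14613Descent.isElliptic
    ∀ [((kubertTateFive (((146 : ℤ) : ℚ)) (((13 : ℤ) : ℚ))).quadraticTwist (-4)).IsElliptic],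
      ((kubertTateFive (((146 : ℤ) : ℚ)) (((13 : ℤ) : ℚ))).quadraticTwist (-4)).mordellWeilRank = 2 ∧
        ((kubertTateFive (((146 : ℤ) : ℚ)) (((13 : ℤ) : ℚ))).quadraticTwist (-4)).shaCorank 5 = 0 ∧
        (kubertTateFive (((146 : ℤ) : ℚ)) (((13 : ℤ) : ℚ))).shaCorank 5 = 0 := by
  intro htw
  haveI : IsCyclotomicExtension {4} ℚ (CyclotomicField 4 ℚ) := CyclotomicField.isCyclotomicExtension 4 ℚ
  exact ⟨mordellWeilRank_twist_eq_two (CyclotomicField 4 ℚ), shaCorank_five_twist_eq_zero (CyclotomicField 4 ℚ),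
    KubertTate14613Descent.shaCorank_five_eq_zero⟩

end KubertTate14613GaussianDescent

end Literature.NumberTheory.EllipticCurves

end
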